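/-
Copyright (c) 2026.  Released under the Apache 2.0 license of this project.
Cell decomp-a2c, lens 4 (minimal-counterexample / extremal reduction), generation 70 — the far layers of the jet model
DISCHARGED to the closed-form main terms: (upper-J)/(lower-J) from a near/far ALGEBRAIC majorisation on the annulus.
-/
import Summits.AtomisticToContinuum.Crystallization.Theorems.OverbindingBudgetAffineRadialJet
import Summits.AtomisticToContinuum.Crystallization.Theorems.OverbindingBudgetAffineFarLayerMain

/-!
# (upper-J) and (lower-J) with the far layers in CLOSED FORM — Z2 from three-zone tables whose jet-annulus obligations are algebraic
# (decomp-a2c lens-4, generation 70: piece J3 of critic row 1246 discharged to the closed-form main terms of `…FarLayerMain`)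

`…RadialJet` (generation 69, revised 70) reduces leaf Z2 to THREE-ZONE tables per sign window; on the jet annulus `r₁ ≤ ‖y − x₀‖ ≤ ρ₁` it asks
(upper-J) `chartScale X⁶·T₃↑ ≤ PJ = S₃ + J₃` and (lower-J) `NJ = S₆ + J₆ ≤ chartScale X¹²·T₆↓`, and its ★★ `hupper_of_chartMajorant` turns
(upper-J) into the chart-level majorisation `Σ rests + chartFarSix y ≤ J₃(y)` with `chartFarSix` an INFINITE coset-max lattice sum over the far
layers (critic row 1246: piece J3, CERT·ATTACKABLE-M; (lower-J) PROVED only for `J₆ ≤ 0`, i.e. the far twelve layers DROPPED).  With the closed forms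
`M₆`, `M₁₂` of `…FarLayerMain` both far parts are explicit algebraic functions of `y` up to one certified row remainder each:

 §1 ★ `chartFarSix_eq`: `chartFarSix (gramChart X) = chartScale X⁶·(T₃↑(w,X) − Σ_{|k|≤3} layerSum X 6 k ℓ_k)` — the chart-level far layers
    ARE the far layers of the window sum; hence ★★ `chartFarSix_le_farMainSix` ((J3a) PROVED): `chartFarSix y ≤ M₆(y) + 2(π/√Dlo)·bound/(1−Q)`
    at `y = gramChart X`, for one far row of index `3` whose normalised box and height floor contain `y`.
 §2 ★★ `hupper_of_nearFarMajorant`: (upper-J) ⟸ ON THE ANNULUS `Σ_{|k|≤3} chartLayerRest 3 y k ℓ_k (S k) + M₆(y) + rem₂ ≤ J₃(y)` ((J3b): the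
    in-plane rests are `…RadialJet.chartLayerRest_le_jet`'s (J2); what is left is ONE inequality between algebraic functions of five variables).
 §3 ★★ `hlower_of_windowFamily_farMain`: (lower-J) for a window-indexed family and ANY jet with `J₆ ≤ M₁₂(N,·) − rem₅` on the annulus — the
    far twelve layers generation 69 dropped (`11 %` of the slack at `r₁ = 3·10⁻³`, memo NODE-g69 §1) are recovered, functionally in `y`.
 §4 ★★★ `farCoreExcess_of_threeZoneFarMainTables`: Z2 from three-zone tables in which EVERY jet-annulus hypothesis (`hmaj`, `hmin`: box ∋ y,
    height floor, majorisation / minorisation with the row's remainder) is an inequality between EXPLICIT ALGEBRAIC FUNCTIONS of `y ∈ E5` (polynomials, `detPar^{−1/2}`, `detFull^{−2}`, `detFull^{−5}`), plus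
    decidable far rows (`FarRow`, window-independent normalised boxes; ONE pair suffices for `ρ₁ ≤ 1/10`, sub-box families with their OWN
    remainders cover wider annuli) — the remaining certificate is interval / Taylor arithmetic over a 5-ball, NO lattice sum
    (census ask Z2-CERT-5D-M of memo NODE-g70 §4); inner/outer tables, radial tables of `ψ_J`, side conditions, hcp enclosures unchanged.

No statement of `…RadialJet` or of the tree is modified or restated; no `sorry`, no new axioms (★★★ closes over
`[propext, Classical.choice, Quot.sound]`).  Tags: ★/★★/★★★ this file · [formal bookkeeping].
-/

noncomputable section

open Set
open scoped Real

namespace Summit.AtomisticToContinuum.Crystallization.Theorems.OverbindingBudgetAffineRadialJetFar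
open Literature.MathematicalPhysics.StatisticalMechanics
open Summit.AtomisticToContinuum.Crystallization.Theorems.OverbindingBudgetAffineFarSmoothSplit
open Summit.AtomisticToContinuum.Crystallization.Theorems.OverbindingBudgetAffineRadialReduction
open Summit.AtomisticToContinuum.Crystallization.Theorems.OverbindingBudgetAffineRadialChart
open Summit.AtomisticToContinuum.Crystallization.Theorems.OverbindingBudgetAffineRadialJet
open Summit.AtomisticToContinuum.Crystallization.Theorems.OverbindingBudgetAffineFarLayerMain

local notation "E3" => EuclideanSpace ℝ (Fin 3)
local notation "E5" => EuclideanSpace ℝ (Fin 5)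

/-! ## §1 The chart-level far layers `chartFarSix` ARE the far layers of `s⁶·T₃↑`; hence below `M₆ + remainder` -/

section FarSix

variable {θ' : ℝ} {w : Fin 6 → ℤ} {X : E3 →ₗ[ℝ] E3}

/-- The seven window layers as `Icc (−3) 3 = Ioo (−4) 4`. [formal bookkeeping] -/
theorem Icc_neg_three_three_eq_Ioo : Finset.Icc (-3 : ℤ) 3 = Finset.Ioo (-4 : ℤ) 4 := by
  ext k
  simp only [Finset.mem_Icc, Finset.mem_Ioo]
  omega

/-- ★ `chartFarSix (gramChart X) = chartScale X⁶ · (T₃↑(w, X) − Σ_{|k|≤3} layerSum X 6 k ℓ_k)` — the chart-level far layers of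
`…RadialJet` ARE the far layers of the window sum (its `scale_pow_six_mul_windowSixUp` with empty near sets). [this file] -/
theorem chartFarSix_eq (hX : FarWindowData (1 / 25) θ' w X) :
    chartFarSix (gramChart X) =
      chartScale X ^ 6 * (windowSixUp w X - ∑ k ∈ Finset.Ioo (-4 : ℤ) 4, layerSum X 6 k (windowLabel w k)) := by
  have hs : chartScale X ≠ 0 := (scale_pos_of_farWindowData (by norm_num) hX).ne'
  have h := scale_pow_six_mul_windowSixUp hX (fun _ => ∅)
  have hrest : ∀ k, chartLayerRest 3 (gramChart X) k (windowLabel w k) ∅ =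
      chartScale X ^ 6 * layerSum X 6 k (windowLabel w k) := by
    intro k
    rw [scale_pow_six_mul_layerSum hs]
    unfold chartLayerRest chartLayerSum
    exact tsum_congr fun ij => by rw [if_neg (Finset.notMem_empty ij)]
  simp only [Finset.sum_empty, Finset.sum_const_zero, zero_add, hrest] at h
  rw [← Finset.mul_sum, Icc_neg_three_three_eq_Ioo] at h
  rw [mul_sub]
  linarith

/-- ★★ **(J3a) PROVED — the far layers of the cube model below the CLOSED-FORM main term.**  For the data of a far window, a
far row of index `3` (packaged side conditions `FarRow R 3 δlo r₀ Q`) whose box contains the normalised planar Gram entries of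
`y = gramChart X`, and the height floor `δlo²·det G_∥(y) ≤ det G(y)`:
`chartFarSix y ≤ M₆(y) + 2·(π/√Dlo)·bound/(1 − Q)`. [this file] -/
theorem chartFarSix_le_farMainSix (hX : FarWindowData (1 / 25) θ' w X) {R : DualRow} {δlo : ℝ} {r₀ : ℚ} {Q : ℝ}
    (hrow : FarRow R 3 δlo r₀ Q) (hbox : InRowBox R (gramChart X))
    (hδ : δlo ^ 2 * detPar (gramChart X) ≤ detFull (gramChart X)) :
    chartFarSix (gramChart X) ≤ farMainSix (gramChart X) + 2 * (π / Real.sqrt R.Dlo * R.bound * (1 / (1 - Q))) := by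
  rw [chartFarSix_eq hX]
  exact far_six_le_of_farRow hX hrow hbox hδ

end FarSix

/-! ## §2 ★★ (upper-J) from the NEAR/FAR ALGEBRAIC MAJORISATION on the annulus -/

section Upper

variable {ι κ : Type*} {θ' : ℝ} {w : Fin 6 → ℤ}

/-- ★★ **(upper-J) ⟸ rests + CLOSED-FORM far main term + the ROW'S remainder below the jet, on the annulus.**  Data: the
family's cube sum IS the near double sum over finite index sets `S k` of the window layers (`hDS`); a family (any index type `κ`; one
row, `κ = Unit`, is the simplest case, SUB-BOXES of the normalised Gram box sharpen `bound` where the annulus is wide) of far rows of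
index `3` (`hrow`, decidable side conditions); and ON THE ANNULUS `{y ∈ KRegion (196/121) : r₁ ≤ ‖y − x₀‖ ≤ ρ₁}` the pointwise ALGEBRAIC
statement `hmaj`: SOME row's box contains `y`, its height floor holds (`δlo² · detPar y ≤ detFull y`), and
`Σ_{|k|≤3} chartLayerRest 3 y k ℓ_k (S k) + M₆(y) + 2(π/√Dlo)·bound/(1−Q) ≤ J₃(y)` with THAT row's remainder (so the remainder may grow with
`‖y − x₀‖` like the slack does).  Then the per-window obligation `hupper` of ★★★ `…RadialJet.farCoreExcess_of_threeZoneJetTables` holds.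
(The in-plane rests are (J2), `…RadialJet.chartLayerRest_le_jet`; the only far object left is the explicit algebraic function `M₆`.) [this file] -/
theorem hupper_of_nearFarMajorant (D : FamilyData E5 ι) (J₃ : JetData E5) (S : ℤ → Finset (ℤ × ℤ))
    (hDS : ∀ y : E5, D.S 2 y = ∑ k ∈ Finset.Icc (-3 : ℤ) 3, ∑ ij ∈ S k, chartTerm 3 y (wIdx w (k, ij)))
    (R : κ → DualRow) {δlo : κ → ℝ} {r₀ : κ → ℚ} {Q : κ → ℝ} (hrow : ∀ i, FarRow (R i) 3 (δlo i) (r₀ i) (Q i))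
    {x₀ : E5} {r₁ ρ₁ : ℝ}
    (hmaj : ∀ y ∈ KRegion (196 / 121), r₁ ≤ ‖y - x₀‖ → ‖y - x₀‖ ≤ ρ₁ → ∃ i, InRowBox (R i) y ∧ δlo i ^ 2 * detPar y ≤ detFull y ∧
      ∑ k ∈ Finset.Icc (-3 : ℤ) 3, chartLayerRest 3 y k (windowLabel w k) (S k) + farMainSix y +
        2 * (π / Real.sqrt (R i).Dlo * (R i).bound * (1 / (1 - Q i))) ≤ J₃.eval y) :
    ∀ X : E3 →ₗ[ℝ] E3, FarWindowData (1 / 25) θ' w X → r₁ ≤ ‖gramChart X - x₀‖ → ‖gramChart X - x₀‖ ≤ ρ₁ →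
      chartScale X ^ 6 * windowSixUp w X ≤ PJ D J₃ (gramChart X) := by
  intro X hX hr hρ
  obtain ⟨i, hb, hδ, h⟩ := hmaj _ (mem_K_record hX) hr hρ
  have hfar := chartFarSix_le_farMainSix hX (hrow i) hb hδ
  rw [scale_pow_six_mul_windowSixUp hX S]
  unfold PJ
  rw [hDS]
  linarith

end Upper

/-! ## §3 ★★ (lower-J) for a window-indexed family and ANY jet minorising the closed-form far twelve main term -/

section Lower

variable {θ' : ℝ} {w : Fin 6 → ℤ}

/-- ★ Finite partial sums of window-layer terms are below the seven WINDOW LAYER SUMS (the proof of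
`…RadialJet.sum_layerTerm_le_windowTwelveLo` stopped one step earlier): for every finite set `T` of lattice triples in the
window layers, `Σ_{t∈T} layerTerm X 12 t.1 ℓ_{t.1} t.2 ≤ Σ_{|k|≤3} layerSum X 12 k ℓ_k`. [this file] -/
theorem sum_layerTerm_le_sum_window_layers {X : E3 →ₗ[ℝ] E3} (hX : FarWindowData (1 / 25) θ' w X)
    (T : Finset (ℤ × ℤ × ℤ)) (hT : ∀ t ∈ T, |t.1| ≤ 3) :
    ∑ t ∈ T, layerTerm X 12 t.1 (windowLabel w t.1) t.2 ≤ ∑ k ∈ Finset.Icc (-3 : ℤ) 3, layerSum X 12 k (windowLabel w k) := by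
  have hs : IsHaggSeq (seqOfWindow w) := isHaggSeq_seqOfWindow hX.1
  have hm : (3 : ℝ) * (1 / 25) ≤ 1 / 6 := by norm_num
  obtain ⟨-, h12⟩ := summable_shapeFamily hs hm hX.2.1
  set f : ℤ × ℤ × ℤ → ℝ := fun t =>
    if |t.1| ≤ 3 then layerTerm X 12 t.1 (haggLabel (seqOfWindow w) t.1) t.2 else 0 with hf
  have hf0 : ∀ t, 0 ≤ f t := fun t => by
    simp only [hf]
    split_ifs
    · exact layerTerm_nonneg _ _ _ _ _
    · exact le_rfl
  have hfle : ∀ t, f t ≤ layerTerm X 12 t.1 (haggLabel (seqOfWindow w) t.1) t.2 := fun t => by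
    simp only [hf]
    split_ifs
    · exact le_rfl
    · exact layerTerm_nonneg _ _ _ _ _
  have hfs : Summable f := Summable.of_nonneg_of_le hf0 hfle h12
  have h1 : ∑ t ∈ T, layerTerm X 12 t.1 (windowLabel w t.1) t.2 = ∑ t ∈ T, f t :=
    Finset.sum_congr rfl fun t ht => by
      simp only [hf, if_pos (hT t ht), haggLabel_seqOfWindow w (hT t ht)]
  have h2 : ∑ t ∈ T, f t ≤ ∑' t, f t := hfs.sum_le_tsum T fun t _ => hf0 t
  have h4 : ∀ k : ℤ, ∑' ij : ℤ × ℤ, f (k, ij) = if |k| ≤ 3 then layerSum X 12 k (windowLabel w k) else 0 := by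
    intro k
    by_cases hk : |k| ≤ 3
    · simp only [hf, if_pos hk, haggLabel_seqOfWindow w hk]
      rfl
    · simp only [hf, if_neg hk, tsum_zero]
  have h5 : ∑' k : ℤ, (if |k| ≤ 3 then layerSum X 12 k (windowLabel w k) else 0) =
      ∑ k ∈ Finset.Icc (-3 : ℤ) 3, layerSum X 12 k (windowLabel w k) := by
    rw [tsum_eq_sum (s := Finset.Icc (-3 : ℤ) 3) (fun k hk => by
      rw [Finset.mem_Icc] at hk
      exact if_neg fun h => hk (abs_le.1 h))]
    refine Finset.sum_congr rfl fun k hk => ?_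
    rw [Finset.mem_Icc] at hk
    rw [if_pos (abs_le.2 ⟨hk.1, hk.2⟩)]
  calc ∑ t ∈ T, layerTerm X 12 t.1 (windowLabel w t.1) t.2 = ∑ t ∈ T, f t := h1
    _ ≤ ∑' t, f t := h2
    _ = ∑' k : ℤ, ∑' ij : ℤ × ℤ, f (k, ij) := hfs.tsum_prod
    _ = ∑' k : ℤ, (if |k| ≤ 3 then layerSum X 12 k (windowLabel w k) else 0) := tsum_congr h4
    _ = ∑ k ∈ Finset.Icc (-3 : ℤ) 3, layerSum X 12 k (windowLabel w k) := h5

/-- ★★ **(lower-J) with a GENUINE far-field minorant.**  For a family indexed by lattice triples of the window layers whose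
affine denominators ARE the chart forms, a family of far rows of index `6` (decidable side conditions), and ANY jet `J₆` such that
pointwise on the annulus SOME row's box contains `y`, its height floor holds and `J₆(y) ≤ M₁₂(N, y) − 2(π/(60√Dlo))·bound/(1−Q)` with
that row's remainder (`hmin`), the per-window obligation `hlower` of ★★★ `…RadialJet.farCoreExcess_of_threeZoneJetTables` holds.
(Generation 69 had to DROP the far twelve layers, `J₆ ≤ 0`; here they are recovered up to the certified remainder.) [this file] -/
theorem hlower_of_windowFamily_farMain {κ : Type*} (D : FamilyData E5 (ℤ × ℤ × ℤ)) (hDs : ∀ t ∈ D.s, |t.1| ≤ 3)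
    (hD : ∀ t ∈ D.s, ∀ y : E5, D.c t + D.L t y = chartForm y (wIdx w t)) (J₆ : JetData E5) (N : ℕ)
    (R : κ → DualRow) {δlo : κ → ℝ} {r₀ : κ → ℚ} {Q : κ → ℝ} (hrow : ∀ i, FarRow (R i) 6 (δlo i) (r₀ i) (Q i))
    {x₀ : E5} {r₁ ρ₁ : ℝ}
    (hmin : ∀ y ∈ KRegion (196 / 121), r₁ ≤ ‖y - x₀‖ → ‖y - x₀‖ ≤ ρ₁ → ∃ i, InRowBox (R i) y ∧ δlo i ^ 2 * detPar y ≤ detFull y ∧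
      J₆.eval y ≤ farMainTwelve N y - 2 * (π / (60 * Real.sqrt (R i).Dlo) * (R i).bound * (1 / (1 - Q i)))) :
    ∀ X : E3 →ₗ[ℝ] E3, FarWindowData (1 / 25) θ' w X → r₁ ≤ ‖gramChart X - x₀‖ → ‖gramChart X - x₀‖ ≤ ρ₁ →
      NJ D J₆ (gramChart X) ≤ chartScale X ^ 12 * windowTwelveLo w X := by
  intro X hX hr hρ
  have hs : 0 < chartScale X := scale_pos_of_farWindowData (by norm_num) hX
  obtain ⟨i, hb, hδ, h3⟩ := hmin _ (mem_K_record hX) hr hρ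
  have hsum : D.S 5 (gramChart X) = chartScale X ^ 12 * ∑ t ∈ D.s, layerTerm X 12 t.1 (windowLabel w t.1) t.2 := by
    unfold FamilyData.S
    rw [Finset.mul_sum]
    refine Finset.sum_congr rfl fun t ht => ?_
    rw [hD t ht, scale_pow_mul_layerTerm_eq hs.ne' t]
  have hNJ : NJ D J₆ (gramChart X) = D.S 5 (gramChart X) + J₆.eval (gramChart X) := rfl
  have h1 := sum_layerTerm_le_sum_window_layers hX D.s hDs
  rw [Icc_neg_three_three_eq_Ioo] at h1
  have h1' := mul_le_mul_of_nonneg_left h1 (pow_nonneg hs.le 12)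
  have h2 := le_far_twelve_of_farRow hX (hrow i) hb hδ N
  rw [hNJ, hsum]
  rw [mul_sub] at h2
  linarith

end Lower

/-! ## §4 ★★★ Z2 from three-zone tables whose jet-annulus obligations are ALGEBRAIC in the chart point -/

section EndToEnd

variable {κ₂ κ₅ : Type*} {c τ l3 L6hi b : ℝ}
  {D : (Fin 6 → ℤ) → FamilyData E5 (ℤ × ℤ × ℤ)} {S : (Fin 6 → ℤ) → ℤ → Finset (ℤ × ℤ)}
  {J₃ J₆ : (Fin 6 → ℤ) → JetData E5} {x₀ : (Fin 6 → ℤ) → E5}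
  {ρ ρ₁ m₀ η δ₀ r₁ : (Fin 6 → ℤ) → ℝ}
  {R₂ : (Fin 6 → ℤ) → κ₂ → DualRow} {δ₂ : (Fin 6 → ℤ) → κ₂ → ℝ} {r₂ : (Fin 6 → ℤ) → κ₂ → ℚ} {Q₂ : (Fin 6 → ℤ) → κ₂ → ℝ}
  {R₅ : (Fin 6 → ℤ) → κ₅ → DualRow} {δ₅ : (Fin 6 → ℤ) → κ₅ → ℝ} {r₅ : (Fin 6 → ℤ) → κ₅ → ℚ} {Q₅ : (Fin 6 → ℤ) → κ₅ → ℝ} {N : ℕ}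

/-- ★★★ **Z2 from THREE-ZONE tables with the far layers in closed form.**  ★★★ `…RadialJet.farCoreExcess_of_threeZoneJetTables`
with BOTH jet-annulus enclosures discharged: per window `w`, a window-indexed near family (`hDS`, `hDs`, `hD`), families of far rows of index
`3` and `6` (`hrow₂`, `hrow₅`: decidable side conditions — the rows do not depend on the window, and one row per exponent suffices for
`ρ₁ ≤ 1/10`; wider annuli take sub-boxes), and ON THE ANNULUS the pointwise NEAR/FAR MAJORISATION `hmaj` (some μ = 2 row's box ∋ y, its height
floor, `rests + M₆ + remainder ≤ J₃`) and FAR MINORISATION `hmin` (some μ = 5 row's box ∋ y, floor, `J₆ ≤ M₁₂(N,·) − remainder`) — all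
inequalities between EXPLICIT ALGEBRAIC FUNCTIONS OF FIVE REAL VARIABLES — plus the unchanged inner/outer tables, radial tables of `ψ_J`, side
conditions and hcp enclosures. [this file] -/
theorem farCoreExcess_of_threeZoneFarMainTables (hc : c ≠ 0) (hτ : 0 < τ) (hτ' : τ ≤ 1 / 100)
    (hl3 : 0 < l3) (hL3 : l3 ≤ StackingSums.hcpInvPowSum 3 c) (hL6 : StackingSums.hcpInvPowSum 6 c ≤ L6hi)
    (hκ : 24 * (1 / (2 * 10 ^ 7) + 1 / 10 ^ 9) * L6hi ≤ l3 ^ 2)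
    (hinner : ∀ w, ∀ X : E3 →ₗ[ℝ] E3, FarWindowData (1 / 25) (1 / 2000 - τ) w X → ‖gramChart X - x₀ w‖ < r₁ w →
      b * windowSixUp w X ^ 2 ≤ windowTwelveLo w X)
    (houter : ∀ w, ∀ X : E3 →ₗ[ℝ] E3, FarWindowData (1 / 25) (1 / 2000 - τ) w X → ρ₁ w < ‖gramChart X - x₀ w‖ →
      b * windowSixUp w X ^ 2 ≤ windowTwelveLo w X)
    (hDS : ∀ w, ∀ y : E5, (D w).S 2 y = ∑ k ∈ Finset.Icc (-3 : ℤ) 3, ∑ ij ∈ S w k, chartTerm 3 y (wIdx w (k, ij)))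
    (hDs : ∀ w, ∀ t ∈ (D w).s, |t.1| ≤ 3)
    (hD : ∀ w, ∀ t ∈ (D w).s, ∀ y : E5, (D w).c t + (D w).L t y = chartForm y (wIdx w t))
    (hrow₂ : ∀ w i, FarRow (R₂ w i) 3 (δ₂ w i) (r₂ w i) (Q₂ w i))
    (hrow₅ : ∀ w i, FarRow (R₅ w i) 6 (δ₅ w i) (r₅ w i) (Q₅ w i))
    (hmaj : ∀ w, ∀ y ∈ KRegion (196 / 121), r₁ w ≤ ‖y - x₀ w‖ → ‖y - x₀ w‖ ≤ ρ₁ w →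
      ∃ i, InRowBox (R₂ w i) y ∧ δ₂ w i ^ 2 * detPar y ≤ detFull y ∧
        ∑ k ∈ Finset.Icc (-3 : ℤ) 3, chartLayerRest 3 y k (windowLabel w k) (S w k) + farMainSix y +
          2 * (π / Real.sqrt (R₂ w i).Dlo * (R₂ w i).bound * (1 / (1 - Q₂ w i))) ≤ (J₃ w).eval y)
    (hmin : ∀ w, ∀ y ∈ KRegion (196 / 121), r₁ w ≤ ‖y - x₀ w‖ → ‖y - x₀ w‖ ≤ ρ₁ w →
      ∃ i, InRowBox (R₅ w i) y ∧ δ₅ w i ^ 2 * detPar y ≤ detFull y ∧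
        (J₆ w).eval y ≤ farMainTwelve N y - 2 * (π / (60 * Real.sqrt (R₅ w i).Dlo) * (R₅ w i).bound * (1 / (1 - Q₅ w i))))
    (hx₀ : ∀ w, x₀ w ∈ KRegion (196 / 121)) (hρ₁ : ∀ w, 0 ≤ ρ₁ w)
    (hpos : ∀ w, ∀ y ∈ KRegion (196 / 121) ∩ Metric.closedBall (x₀ w) (ρ₁ w), ∀ i ∈ (D w).s, (D w).c i + (D w).L i y ≠ 0)
    (hP : ∀ w, ∀ y ∈ KRegion (196 / 121) ∩ Metric.closedBall (x₀ w) (ρ₁ w), 0 < PJ (D w) (J₃ w) y)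
    (hC : ∀ w, ∀ y ∈ KRegion (196 / 121) ∩ Metric.closedBall (x₀ w) (ρ₁ w), ‖y - x₀ w‖ ≤ ρ w → ∀ u : E5, ‖u‖ = 1 →
      m₀ w ≤ psiJ₂ (D w) (J₃ w) (J₆ w) y u)
    (hB : ∀ w, ∀ y ∈ KRegion (196 / 121) ∩ Metric.closedBall (x₀ w) (ρ₁ w), ρ w ≤ ‖y - x₀ w‖ →
      0 < psiJ₁ (D w) (J₃ w) (J₆ w) y (‖y - x₀ w‖⁻¹ • (y - x₀ w)) ∨
        0 < psiJ₂ (D w) (J₃ w) (J₆ w) y (‖y - x₀ w‖⁻¹ • (y - x₀ w)))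
    (hG : ∀ w, ∀ u : E5, ‖u‖ = 1 → -η w ≤ psiJ₁ (D w) (J₃ w) (J₆ w) (x₀ w) u)
    (h0 : ∀ w, b - δ₀ w ≤ psiJ (D w) (J₃ w) (J₆ w) (x₀ w))
    (hr₁ : ∀ w, 0 < r₁ w) (hrρ : ∀ w, r₁ w ≤ ρ w)
    (hq : ∀ w, ∀ t ∈ Icc (r₁ w) (ρ w), δ₀ w + η w * t ≤ m₀ w / 2 * t ^ 2) (hρη : ∀ w, η w < m₀ w * ρ w)
    (hb : 0 ≤ b) (hbD : L6hi ≤ b * (l3 ^ 2 - 24 * (1 / (2 * 10 ^ 7) + 1 / 10 ^ 9) * L6hi)) :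
    FarCoreExcess (1 / 25) (1 / 2000) (1 / (2 * 10 ^ 7)) :=
  farCoreExcess_of_threeZoneJetTables hc hτ hτ' hl3 hL3 hL6 hκ hinner houter
    (fun w => hupper_of_nearFarMajorant (D w) (J₃ w) (S w) (hDS w) (R₂ w) (hrow₂ w) (hmaj w))
    (fun w => hlower_of_windowFamily_farMain (D w) (hDs w) (hD w) (J₆ w) N (R₅ w) (hrow₅ w) (hmin w))
    hx₀ hρ₁ hpos hP hC hB hG h0 hr₁ hrρ hq hρη hb hbD

end EndToEnd

end Summit.AtomisticToContinuum.Crystallization.Theorems.OverbindingBudgetAffineRadialJetFar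

end
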